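import Mathlib
import Summits.ValiantsHypothesis.ValiantsHypothesis.Theorems.RigidityForcesSymmetryRankRigidMinimalReprLaplaceFiveSeparatedCaptureSliceRows

/-!
# The slice chains fed with the row information

The two- and three-letter slice chains (✓ `SliceChain`) for a slot killing two or three letters, fed with the residue form of the
coordinate slices (✓ `sliceCoord_residue_01` of `SliceRows`): the spaces `Y_i` need only contain the symmetric zero-diagonal matrices
`v + N` with `v` in the slot and `N ∈ X` having all rows in `rowIm X c_i`.  Tools for the case trees of the 3-slot capture inequality
`CaptureIneqSym` (item 24813 stays OPEN).  All [folklore].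
-/

set_option linter.dupNamespace false
set_option autoImplicit false

namespace Summit.ValiantsHypothesis.ValiantsHypothesis.Theorems.RigidityForcesSymmetryRankRigidMinimalRepr

namespace LaplaceFiveSeparatedCapture

open Finset

/-- ★★★ **TWO ZERO ROWS IN `U₀₁`, ROW-REFINED.**  Every matrix of `U₀₁` has rows `c₁, c₂` zero (e.g. `U₀₁ = ℂu`, `u` on three letters;
`U₀₂, U₁₂` ARBITRARY symmetric).  Then `finrank W ≤ finrank Y₁ + finrank Y₂ + 1` for any `Y₁` containing the symmetric zero-diagonal
`M` with row `c₁` zero of the form `v + N` (`v ∈ U₀₁`, `N ∈ X`, rows of `N` in `rowIm X c₁`), and any `Y₂` containing those with rows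
`c₁, c₂` zero of the form `v + N` (`v ∈ U₀₁`, `N ∈ X`, rows of `N` in `rowIm X c₂`).  When no member of `U₀₂ ⊔ U₁₂` touches the
letter `c₁`, `N = 0` and `Y₁` may be taken inside `U₀₁`. [folklore] -/
theorem finrank_le_of_two_zero_rows_rows_01 (U01 U02 U12 W Y₁ Y₂ : Submodule ℂ (Fin 5 → Fin 5 → ℂ))
    (h01 : ∀ x ∈ U01, ∀ p q : Fin 5, x p q = x q p) (h02 : ∀ x ∈ U02, ∀ p q : Fin 5, x p q = x q p)
    (h12 : ∀ x ∈ U12, ∀ p q : Fin 5, x p q = x q p)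
    (c₁ c₂ a b e : Fin 5) (hcov : ∀ x : Fin 5, x = c₁ ∨ x = c₂ ∨ x = a ∨ x = b ∨ x = e)
    (hr₁ : ∀ x ∈ U01, ∀ q : Fin 5, x c₁ q = 0) (hr₂ : ∀ x ∈ U01, ∀ q : Fin 5, x c₂ q = 0)
    (hY₁ : ∀ M : Fin 5 → Fin 5 → ℂ, (∀ p q : Fin 5, M p q = M q p) → (∀ p : Fin 5, M p p = 0) → (∀ q : Fin 5, M c₁ q = 0) →
      (∃ v ∈ U01, ∃ N ∈ U01 ⊔ U02 ⊔ U12, (∀ p : Fin 5, (fun q => N p q) ∈ rowIm (U01 ⊔ U02 ⊔ U12) c₁) ∧ M = v + N) → M ∈ Y₁)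
    (hY₂ : ∀ M : Fin 5 → Fin 5 → ℂ, (∀ p q : Fin 5, M p q = M q p) → (∀ p : Fin 5, M p p = 0) → (∀ q : Fin 5, M c₁ q = 0) →
      (∀ q : Fin 5, M c₂ q = 0) →
      (∃ v ∈ U01, ∃ N ∈ U01 ⊔ U02 ⊔ U12, (∀ p : Fin 5, (fun q => N p q) ∈ rowIm (U01 ⊔ U02 ⊔ U12) c₂) ∧ M = v + N) → M ∈ Y₂)
    (hWs : ∀ μ ∈ W, ∀ s t : Fin 5, μ s t = μ t s) (hWd : ∀ μ ∈ W, ∀ s : Fin 5, μ s s = 0)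
    (hWc : ∀ μ ∈ W, contractZ μ ∈ L3 U01 U02 U12) :
    Module.finrank ℂ W ≤ Module.finrank ℂ Y₁ + Module.finrank ℂ Y₂ + 1 := by
  refine finrank_le_of_two_slices_chain W Y₁ Y₂ hWs hWd c₁ c₂ a b e hcov (fun μ hμ => ?_) (fun μ hμ h0 => ?_)
  · obtain ⟨hs, hd, hr, -⟩ := sliceCoord_shape μ c₁
    exact hY₁ _ hs hd hr (sliceCoord_residue_01 U01 U02 U12 h01 h02 h12 c₁ hr₁ μ (hWc μ hμ))
  · obtain ⟨hs, hd, hr, -⟩ := sliceCoord_shape μ c₂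
    exact hY₂ _ hs hd (sliceCoord_row_eq_zero_of_slice_eq_zero μ c₁ c₂ h0) hr
      (sliceCoord_residue_01 U01 U02 U12 h01 h02 h12 c₂ hr₂ μ (hWc μ hμ))

/-- ★★★ **THREE ZERO ROWS IN `U₀₁`, ROW-REFINED** (e.g. `U₀₁ = ℂu` with `u` supported on a pair of letters `{a, b}` or `u = x_aa`;
`U₀₂, U₁₂` ARBITRARY): `finrank W ≤ finrank Y₁ + finrank Y₂ + finrank Y₃` with the nested, row-refined hypotheses. [folklore] -/
theorem finrank_le_of_three_zero_rows_rows_01 (U01 U02 U12 W Y₁ Y₂ Y₃ : Submodule ℂ (Fin 5 → Fin 5 → ℂ))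
    (h01 : ∀ x ∈ U01, ∀ p q : Fin 5, x p q = x q p) (h02 : ∀ x ∈ U02, ∀ p q : Fin 5, x p q = x q p)
    (h12 : ∀ x ∈ U12, ∀ p q : Fin 5, x p q = x q p)
    (c₁ c₂ c₃ a b : Fin 5) (hcov : ∀ x : Fin 5, x = c₁ ∨ x = c₂ ∨ x = a ∨ x = b ∨ x = c₃)
    (hr₁ : ∀ x ∈ U01, ∀ q : Fin 5, x c₁ q = 0) (hr₂ : ∀ x ∈ U01, ∀ q : Fin 5, x c₂ q = 0)
    (hr₃ : ∀ x ∈ U01, ∀ q : Fin 5, x c₃ q = 0)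
    (hY₁ : ∀ M : Fin 5 → Fin 5 → ℂ, (∀ p q : Fin 5, M p q = M q p) → (∀ p : Fin 5, M p p = 0) → (∀ q : Fin 5, M c₁ q = 0) →
      (∃ v ∈ U01, ∃ N ∈ U01 ⊔ U02 ⊔ U12, (∀ p : Fin 5, (fun q => N p q) ∈ rowIm (U01 ⊔ U02 ⊔ U12) c₁) ∧ M = v + N) → M ∈ Y₁)
    (hY₂ : ∀ M : Fin 5 → Fin 5 → ℂ, (∀ p q : Fin 5, M p q = M q p) → (∀ p : Fin 5, M p p = 0) → (∀ q : Fin 5, M c₁ q = 0) →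
      (∀ q : Fin 5, M c₂ q = 0) →
      (∃ v ∈ U01, ∃ N ∈ U01 ⊔ U02 ⊔ U12, (∀ p : Fin 5, (fun q => N p q) ∈ rowIm (U01 ⊔ U02 ⊔ U12) c₂) ∧ M = v + N) → M ∈ Y₂)
    (hY₃ : ∀ M : Fin 5 → Fin 5 → ℂ, (∀ p q : Fin 5, M p q = M q p) → (∀ p : Fin 5, M p p = 0) → (∀ q : Fin 5, M c₁ q = 0) →
      (∀ q : Fin 5, M c₂ q = 0) → (∀ q : Fin 5, M c₃ q = 0) →
      (∃ v ∈ U01, ∃ N ∈ U01 ⊔ U02 ⊔ U12, (∀ p : Fin 5, (fun q => N p q) ∈ rowIm (U01 ⊔ U02 ⊔ U12) c₃) ∧ M = v + N) → M ∈ Y₃)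
    (hWs : ∀ μ ∈ W, ∀ s t : Fin 5, μ s t = μ t s) (hWd : ∀ μ ∈ W, ∀ s : Fin 5, μ s s = 0)
    (hWc : ∀ μ ∈ W, contractZ μ ∈ L3 U01 U02 U12) :
    Module.finrank ℂ W ≤ Module.finrank ℂ Y₁ + Module.finrank ℂ Y₂ + Module.finrank ℂ Y₃ := by
  refine finrank_le_of_three_slices_chain W Y₁ Y₂ Y₃ hWs hWd c₁ c₂ c₃ a b hcov (fun μ hμ => ?_) (fun μ hμ h0 => ?_)
    (fun μ hμ h0 h0' => ?_)
  · obtain ⟨hs, hd, hr, -⟩ := sliceCoord_shape μ c₁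
    exact hY₁ _ hs hd hr (sliceCoord_residue_01 U01 U02 U12 h01 h02 h12 c₁ hr₁ μ (hWc μ hμ))
  · obtain ⟨hs, hd, hr, -⟩ := sliceCoord_shape μ c₂
    exact hY₂ _ hs hd (sliceCoord_row_eq_zero_of_slice_eq_zero μ c₁ c₂ h0) hr
      (sliceCoord_residue_01 U01 U02 U12 h01 h02 h12 c₂ hr₂ μ (hWc μ hμ))
  · obtain ⟨hs, hd, hr, -⟩ := sliceCoord_shape μ c₃
    exact hY₃ _ hs hd (sliceCoord_row_eq_zero_of_slice_eq_zero μ c₁ c₃ h0)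
      (sliceCoord_row_eq_zero_of_slice_eq_zero μ c₂ c₃ h0') hr
      (sliceCoord_residue_01 U01 U02 U12 h01 h02 h12 c₃ hr₃ μ (hWc μ hμ))

/-- ★★ **A LETTER TOUCHED ONLY BY THE LINE-FREE SLOT.**  `U₀₁ = ℂu` with rows `c₁, c₂` of `u` zero, and NO member of the joint span
touching the letter `c₁` (`rowIm X c₁ = ⊥`, i.e. every `x ∈ X` has row `c₁` zero): then the `c₁`-slices are multiples of `u`, and
`finrank W ≤ 1 + finrank Y₂ + 1` for any admissible `Y₂` at `c₂`. [folklore] -/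
theorem finrank_le_of_untouched_letter_01 (u : Fin 5 → Fin 5 → ℂ) (hu : ∀ p q, u p q = u q p)
    (U02 U12 W Y₂ : Submodule ℂ (Fin 5 → Fin 5 → ℂ))
    (h02 : ∀ x ∈ U02, ∀ p q : Fin 5, x p q = x q p) (h12 : ∀ x ∈ U12, ∀ p q : Fin 5, x p q = x q p)
    (c₁ c₂ a b e : Fin 5) (hcov : ∀ x : Fin 5, x = c₁ ∨ x = c₂ ∨ x = a ∨ x = b ∨ x = e)
    (hu₁ : ∀ q : Fin 5, u c₁ q = 0) (hu₂ : ∀ q : Fin 5, u c₂ q = 0)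
    (hX₁ : ∀ x ∈ (ℂ ∙ u) ⊔ U02 ⊔ U12, ∀ q : Fin 5, x c₁ q = 0)
    (hY₂ : ∀ M : Fin 5 → Fin 5 → ℂ, (∀ p q : Fin 5, M p q = M q p) → (∀ p : Fin 5, M p p = 0) → (∀ q : Fin 5, M c₁ q = 0) →
      (∀ q : Fin 5, M c₂ q = 0) →
      (∃ v ∈ (ℂ ∙ u), ∃ N ∈ (ℂ ∙ u) ⊔ U02 ⊔ U12, (∀ p : Fin 5, (fun q => N p q) ∈ rowIm ((ℂ ∙ u) ⊔ U02 ⊔ U12) c₂) ∧ M = v + N) →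
      M ∈ Y₂)
    (hWs : ∀ μ ∈ W, ∀ s t : Fin 5, μ s t = μ t s) (hWd : ∀ μ ∈ W, ∀ s : Fin 5, μ s s = 0)
    (hWc : ∀ μ ∈ W, contractZ μ ∈ L3 (ℂ ∙ u) U02 U12) :
    Module.finrank ℂ W ≤ 1 + Module.finrank ℂ Y₂ + 1 := by
  have h01 : ∀ x ∈ (ℂ ∙ u), ∀ p q : Fin 5, x p q = x q p := by
    intro x hx p q
    obtain ⟨t, rfl⟩ := Submodule.mem_span_singleton.mp hx
    simp only [Pi.smul_apply, smul_eq_mul, hu p q]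
  have hr : ∀ c, (∀ q, u c q = 0) → ∀ x ∈ (ℂ ∙ u), ∀ q : Fin 5, x c q = 0 := by
    intro c hc x hx q
    obtain ⟨t, rfl⟩ := Submodule.mem_span_singleton.mp hx
    simp only [Pi.smul_apply, smul_eq_mul, hc q, mul_zero]
  -- rows in `rowIm X c₁ = ⊥` vanish, so the `c₁`-slices lie in `ℂ u`
  have hrow0 : ∀ w ∈ rowIm ((ℂ ∙ u) ⊔ U02 ⊔ U12) c₁, w = 0 := by
    rintro _ ⟨x, hx, rfl⟩
    funext q
    exact hX₁ x hx q
  have hline : Module.finrank ℂ (ℂ ∙ u) ≤ 1 := by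
    have := finrank_span_le_card (R := ℂ) ({u} : Set (Fin 5 → Fin 5 → ℂ))
    simpa using this
  refine (finrank_le_of_two_zero_rows_rows_01 (ℂ ∙ u) U02 U12 W (ℂ ∙ u) Y₂ h01 h02 h12 c₁ c₂ a b e hcov (hr c₁ hu₁) (hr c₂ hu₂)
    (fun M _ _ _ hM => ?_) hY₂ hWs hWd hWc).trans (by omega)
  obtain ⟨v, hv, N, -, hN, rfl⟩ := hM
  have hN0 : N = 0 := by
    funext p q
    exact congrFun (hrow0 _ (hN p)) q
  rw [hN0, add_zero]
  exact hv

end LaplaceFiveSeparatedCapture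

end Summit.ValiantsHypothesis.ValiantsHypothesis.Theorems.RigidityForcesSymmetryRankRigidMinimalRepr
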